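import Summits.QuantumFields.BalabanUV.Beta.FP.TowerHN2RowDoor
import Summits.QuantumFields.BalabanUV.Beta.FP.TowerHN2RowGraded

/-!
# `BalabanUV.Beta.FP.TowerHN2RowDoorGraded` — road «FP», binder row D1, ROUTE T, (T1) (XREAD-1 B5; an2 W-2 (A)(2), PART 93∕94): **`TowerHN2RowDoor` WITH THE SECOND-ORDER
# N-FAMILY READ AT THE GRADED RECORD** — the door-carrying H-row `½•(H′₂f sym) = Ŵ♮_wound|ff + D` with `Ŵ` the GRADED composite family and the (J-Λ₂)+D display's mixed words at
# `(tabsCompG (n+2) …).mixFF`; = `TowerHN2RowDoor`'s corollary construction over `TowerHN2RowGraded.hHN2_of_locks_of_junctions_graded` and `WoundEvenCovariantFamily.perF_dper_woundEvenG_wrap`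
# — the letter the (T1) ONE file's `hHN₂` calls in place of `hHN2_family_of_locks_of_junctions_door` (its `hM₂′` then unifies at the display)

WHY (journal: road XREAD-1 l.69131 B5, A-3 l.69140 (3)(iii); an2 W-2 l.69137 (A), W-4 l.69145; chair XV1 l.69144 K1–K4).  v10's ONE file derives `hHN₂` through
`TowerHN2RowMixedDoor → TowerHN2RowDoor → TowerHN2Row`, all of which take the mixed table and the N second-order family BY TEXT (`(tabsComp …).mixFF`, `WN`); under (T1)
(`hM₂′` = `compMixG`, V11-DELTA §2) the chain ends in the GRADED family (an2 FINDING AN2-84-1) and the farm refuses v10's letters («hM₂ n B has type … compMixG … but is expected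
… (tabsComp …).mixFF …»).  THIS FILE is the graded TEXT twin — no mathematics moves; generator `g61/rec/mkHN2RowGraded.py` over the TREE bytes (token counts asserted).
HONEST (an2 FINDING AN2-84-1, said here so no reader takes this for more than it is): with the graded table the (K2b) remainder is ABSENT and the END consumer pins `WN`, so the
door the ONE file must display becomes `WNG − WN` with a NEW tadpole junction `hX′` — by value first; nothing of that is typed here.

WHAT ([folklore] `Matrix`∕`Finset`∕`tsum` bookkeeping BY NAME; no `def`, no `def … : Prop`, nothing cited, 0 sorry):
§1 **`hHN2_of_locks_of_junctions_door_graded`**, §2 **`hHN2_family_of_locks_of_junctions_door_graded (μ y ν y′)`** — `TowerHN2RowDoor`'s statements with the two tokens moved,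
proofs VERBATIM with the two callees swapped.
WHAT THIS IS NOT: not the door's value or form; nothing of Bałaban's asserted, valued or discharged; 0 estimates; 0∕4 row-D1 binders (hW, hR, D1Tel, D1Rep); ROOT M‴ p325680 ∕
P5c ∕ D6 untouched; NOT (C1), NOT (T-ID), NOT D1, NEVER «G-an2-4 closed», NOT BetaPertH, NOT continuum, NOT Clay.

HONEST DEPENDENCY (page 1, mandatory): continuum YM on T⁴ ⇐ BetaPertH ∧ nine spine estimates (0/9 proved); BetaPertH ⇐ (D1) ∧ (D4) ∧ CAP+tail;
G-an2-4 gates asym, D1 and NE2/3/4.  HONEST FRAMING (cell contract, verbatim): «discharging `BetaPertH` makes Bałaban's UV stability UNCONDITIONAL —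
a real constructive-QFT result; it is NOT the continuum limit and NOT the Clay problem.»  ABSOLUTE RULE (cell charter, verbatim): «No internally-minted
statement may enter as a cited fact. Every hypothesis is either kernel-proved in this package or a verbatim quotation of a PUBLISHED theorem with page
reference. The manuscript(s) under audit are NOT citable for their own disputed steps — they are the thing under adjudication; programme-internal
(2001/route/tribunal) claims are never citable.»  Road «FP» OWNER, b2b-balaban-beta-d1-p3 gen 61, 2026-08-30.  No existing file touched.
-/

noncomputable section

open scoped BigOperators

namespace Summit.QuantumFields.BalabanUV.Beta.FP.TowerHN2RowDoorGraded

open Finset Matrix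

open Finset Matrix
open Literature.MathematicalPhysics.QuantumFieldTheory
open Literature.MathematicalPhysics.QuantumFieldTheory.Balaban1983to89
open Literature.MathematicalPhysics.QuantumFieldTheory.Balaban1983to89.Beta
open B4TorusKernel.MultiPeriod (translate)
open B5Prop11Plancherel (fine)
open B6Lemma24Torus (pbox)
open AffineAveraging (Site box toSite)
open AveragingContoursRooted (ctr ctrOff)
open OneStepResolventKernel (Fib)
open StepJetData (wilsonA)
open WilsonBiStencil (wilsonW₂)
open BalabanStepW2 (M2Of)
open Summit.QuantumFields.BalabanUV.Beta.TameKernelCalculus (trK)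
open Summit.QuantumFields.BalabanUV.Beta.BorderedHessian (sgnK)
open Summit.QuantumFields.BalabanUV.Beta.SymShiftedSpread (bhKStepSh)
open Summit.QuantumFields.BalabanUV.Beta.DshAn1 (Dsh)
open Summit.QuantumFields.BalabanUV.Beta.AxialDressingRooted (one_le_of_neZero)
open Summit.QuantumFields.BalabanUV.Beta.CompositeOneShotJets (tabsComp)
open Summit.QuantumFields.BalabanUV.Beta.CompositeOneShotJetData (Roots Pins AN WN)
open Summit.QuantumFields.BalabanUV.Beta.FP.KernelPeriodisationFib (Idx perF)
open Summit.QuantumFields.BalabanUV.Beta.FP.KernelPeriodisationFibLoc (dper)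
open Summit.QuantumFields.BalabanUV.Beta.FP.TorusGaugeCovariance (tgrad)
open Summit.QuantumFields.BalabanUV.Beta.FP.TorusGaugeCovariancePairing (wrapPt)
open Summit.QuantumFields.BalabanUV.Beta.FP.TorusCompositeObjects (towerTorus)
open Summit.QuantumFields.BalabanUV.Beta.FP.TowerQN2RowCopies (towerTorus_fine_apply)
open Summit.QuantumFields.BalabanUV.Beta.FP.TowerHN2RowJet (Hprime2_symm_eq_sq_smul_bivertex_cols_add_rem)
open Summit.QuantumFields.BalabanUV.Beta.NVertexGradedRecord (perF_dper_wound_WNG_evenHalf_inl_inl_eq_sum)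
open Summit.QuantumFields.BalabanUV.Beta.FP.TorusGaugeCovariancePairing (wrapPt_coe)
open Summit.QuantumFields.BalabanUV.Beta.FP.WoundEvenCovariantFamily (perF_dper_woundEvenG_wrap)
open Summit.QuantumFields.BalabanUV.Beta.FP.TowerHN2RowGraded (hHN2_of_locks_of_junctions_graded)
open Summit.QuantumFields.BalabanUV.Beta.ChartStepJets (WchartOf)
open Summit.QuantumFields.BalabanUV.Beta.CompositeCorrectorDress (compChart)
open Summit.QuantumFields.BalabanUV.Beta.CompositeOneShotJetsGraded (tabsCompG)

/-! ## §1 The row at one source pair with the door moved right -/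

section Row

variable {Lc : ℕ} [NeZero Lc] (M : Fin (3 + 1) → ℕ) [∀ μ, NeZero (M μ)] (n : ℕ) (c : ℝ) (Pn : Pins)
  {κ : Type*} [DecidableEq κ] (yN : κ → Site (3 + 1)) (μN : κ → Fin (3 + 1))
  -- #7 `TowerHN2RowJet` §3's letters VERBATIM
  (hv : (κ → ℝ) → (↥(pbox (towerTorus Lc (fine Lc M) (n + 1))) × Fin (3 + 1) → ℝ))
  (hhvl : ∀ (r : ℝ) (x y : κ → ℝ), hv (r • x + y) = r • hv x + hv y)
  (lv : (κ → ℝ) → (↥(pbox (towerTorus Lc (fine Lc M) (n + 1))) → ℝ))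
  (hlv : ∀ (r : ℝ) (x y : κ → ℝ), lv (r • x + y) = r • lv x + lv y)
  (hJW : ∀ (a : κ) (b : ↥(pbox (towerTorus Lc (fine Lc M) (n + 1))) × Fin (3 + 1)), hv (Pi.single a 1) b
      = perF (towerTorus Lc (fine Lc M) (n + 1)) (AN (Roots.ctr Lc) (n + 1)) (b.1, Sum.inl b.2)
          (wrapPt (towerTorus Lc (fine Lc M) (n + 1)) (((Lc ^ (n + 1 + 1) : ℕ) : ℤ) • yN a), Sum.inr (μN a))
        - ∑ s : ↥(pbox (towerTorus Lc (fine Lc M) (n + 1))), tgrad (towerTorus Lc (fine Lc M) (n + 1)) (b.1, Sum.inl b.2) s * lv (Pi.single a 1) s)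
  {H₀ : Matrix (↥(pbox (towerTorus Lc (fine Lc M) (n + 1))) × Fin (3 + 1)) (↥(pbox (towerTorus Lc (fine Lc M) (n + 1))) × Fin (3 + 1)) ℝ}
  (hH₀ : H₀ = (perF (towerTorus Lc (fine Lc M) (n + 1)) (bhKStepSh 3 Lc (Dsh Lc) 0)).submatrix
      (fun b : ↥(pbox (towerTorus Lc (fine Lc M) (n + 1))) × Fin (3 + 1) => ((b.1, Sum.inl b.2) : Idx (towerTorus Lc (fine Lc M) (n + 1)) (Fib 3)))
      (fun b : ↥(pbox (towerTorus Lc (fine Lc M) (n + 1))) × Fin (3 + 1) => ((b.1, Sum.inl b.2) : Idx (towerTorus Lc (fine Lc M) (n + 1)) (Fib 3))))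
  -- THE TABLE LETTER: the road's displayed bi-table IS the pair-symmetrised `ff` block of the row's wound even Wilson bi-stencil `Ŵ₂ᵉ` at the pin table `Pn.T (n+2)` (PART 23)
  (T₂ : ↥(pbox (towerTorus Lc (fine Lc M) (n + 1))) × Fin (3 + 1) → ↥(pbox (towerTorus Lc (fine Lc M) (n + 1))) × Fin (3 + 1) → Matrix (↥(pbox (towerTorus Lc (fine Lc M) (n + 1))) × Fin (3 + 1)) (↥(pbox (towerTorus Lc (fine Lc M) (n + 1))) × Fin (3 + 1)) ℝ)
  (hT₂ : ∀ b b' : ↥(pbox (towerTorus Lc (fine Lc M) (n + 1))) × Fin (3 + 1), T₂ b b' = (1 / 2 : ℝ) • ((perF (towerTorus Lc (fine Lc M) (n + 1)) (dper (towerTorus Lc (fine Lc M) (n + 1)) (fun X Z i₁ i₂ => ∑' m : Site (3 + 1),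
              ((1 / 2 : ℝ) • (wilsonW₂ 3 (Pn.T (n + 1 + 1)) b.2 (b.1 : Site (3 + 1)) b'.2 (translate (towerTorus Lc (fine Lc M) (n + 1)) (b'.1 : Site (3 + 1)) m)
                + sgnK (trK (wilsonW₂ 3 (Pn.T (n + 1 + 1)) b.2 (b.1 : Site (3 + 1)) b'.2 (translate (towerTorus Lc (fine Lc M) (n + 1)) (b'.1 : Site (3 + 1)) m))))) X Z i₁ i₂))).submatrix
            (fun b : ↥(pbox (towerTorus Lc (fine Lc M) (n + 1))) × Fin (3 + 1) => ((b.1, Sum.inl b.2) : Idx (towerTorus Lc (fine Lc M) (n + 1)) (Fib 3)))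
            (fun b : ↥(pbox (towerTorus Lc (fine Lc M) (n + 1))) × Fin (3 + 1) => ((b.1, Sum.inl b.2) : Idx (towerTorus Lc (fine Lc M) (n + 1)) (Fib 3)))
        + (perF (towerTorus Lc (fine Lc M) (n + 1)) (dper (towerTorus Lc (fine Lc M) (n + 1)) (fun X Z i₁ i₂ => ∑' m : Site (3 + 1),
              ((1 / 2 : ℝ) • (wilsonW₂ 3 (Pn.T (n + 1 + 1)) b'.2 (b'.1 : Site (3 + 1)) b.2 (translate (towerTorus Lc (fine Lc M) (n + 1)) (b.1 : Site (3 + 1)) m)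
                + sgnK (trK (wilsonW₂ 3 (Pn.T (n + 1 + 1)) b'.2 (b'.1 : Site (3 + 1)) b.2 (translate (towerTorus Lc (fine Lc M) (n + 1)) (b.1 : Site (3 + 1)) m))))) X Z i₁ i₂))).submatrix
            (fun b : ↥(pbox (towerTorus Lc (fine Lc M) (n + 1))) × Fin (3 + 1) => ((b.1, Sum.inl b.2) : Idx (towerTorus Lc (fine Lc M) (n + 1)) (Fib 3)))
            (fun b : ↥(pbox (towerTorus Lc (fine Lc M) (n + 1))) × Fin (3 + 1) => ((b.1, Sum.inl b.2) : Idx (towerTorus Lc (fine Lc M) (n + 1)) (Fib 3)))))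
  -- (J-X₂): the table's ORDER-2 PURE-GAUGE ROW against `hH₁f`'s cubic Wilson table (displayed; for an1's table the shape of `CombWilsonT2Periodised(K2).torus_H2_pureGauge_*`)
  (hX₂ : ∀ (b : ↥(pbox (towerTorus Lc (fine Lc M) (n + 1))) × Fin (3 + 1)) (lam : ↥(pbox (towerTorus Lc (fine Lc M) (n + 1))) → ℝ),
    ∑ b' : ↥(pbox (towerTorus Lc (fine Lc M) (n + 1))) × Fin (3 + 1), (∑ s : ↥(pbox (towerTorus Lc (fine Lc M) (n + 1))), tgrad (towerTorus Lc (fine Lc M) (n + 1)) (b'.1, Sum.inl b'.2) s * lam s) • T₂ b b'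
      = (1 / 2 : ℝ) • ((perF (towerTorus Lc (fine Lc M) (n + 1)) (dper (towerTorus Lc (fine Lc M) (n + 1)) (wilsonA 3 b.2 (b.1 : Site (3 + 1))))).submatrix
            (fun b : ↥(pbox (towerTorus Lc (fine Lc M) (n + 1))) × Fin (3 + 1) => ((b.1, Sum.inl b.2) : Idx (towerTorus Lc (fine Lc M) (n + 1)) (Fib 3)))
            (fun b : ↥(pbox (towerTorus Lc (fine Lc M) (n + 1))) × Fin (3 + 1) => ((b.1, Sum.inl b.2) : Idx (towerTorus Lc (fine Lc M) (n + 1)) (Fib 3))) * Matrix.diagonal (fun b : ↥(pbox (towerTorus Lc (fine Lc M) (n + 1))) × Fin (3 + 1) => lam b.1)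
        - Matrix.diagonal (fun b : ↥(pbox (towerTorus Lc (fine Lc M) (n + 1))) × Fin (3 + 1) => lam b.1) * (perF (towerTorus Lc (fine Lc M) (n + 1)) (dper (towerTorus Lc (fine Lc M) (n + 1)) (wilsonA 3 b.2 (b.1 : Site (3 + 1))))).submatrix
            (fun b : ↥(pbox (towerTorus Lc (fine Lc M) (n + 1))) × Fin (3 + 1) => ((b.1, Sum.inl b.2) : Idx (towerTorus Lc (fine Lc M) (n + 1)) (Fib 3)))
            (fun b : ↥(pbox (towerTorus Lc (fine Lc M) (n + 1))) × Fin (3 + 1) => ((b.1, Sum.inl b.2) : Idx (towerTorus Lc (fine Lc M) (n + 1)) (Fib 3)))))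
  (Λ₁ : (κ → ℝ) → Matrix (↥(pbox (towerTorus Lc (fine Lc M) (n + 1))) × Fin (3 + 1)) (↥(pbox (towerTorus Lc (fine Lc M) (n + 1))) × Fin (3 + 1)) ℝ)
  (H₁f : (κ → ℝ) → Matrix (↥(pbox (towerTorus Lc (fine Lc M) (n + 1))) × Fin (3 + 1)) (↥(pbox (towerTorus Lc (fine Lc M) (n + 1))) × Fin (3 + 1)) ℝ)
  (hH₁ : ∀ v, H₁f v = (-2 * c) • ∑ b : ↥(pbox (towerTorus Lc (fine Lc M) (n + 1))) × Fin (3 + 1), hv v b •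
        (perF (towerTorus Lc (fine Lc M) (n + 1)) (dper (towerTorus Lc (fine Lc M) (n + 1)) (wilsonA 3 b.2 (b.1 : Site (3 + 1))))).submatrix
            (fun b : ↥(pbox (towerTorus Lc (fine Lc M) (n + 1))) × Fin (3 + 1) => ((b.1, Sum.inl b.2) : Idx (towerTorus Lc (fine Lc M) (n + 1)) (Fib 3)))
            (fun b : ↥(pbox (towerTorus Lc (fine Lc M) (n + 1))) × Fin (3 + 1) => ((b.1, Sum.inl b.2) : Idx (towerTorus Lc (fine Lc M) (n + 1)) (Fib 3)))
      + Λ₁ v)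
  (Λ₂ : (κ → ℝ) → (κ → ℝ) → Matrix (↥(pbox (towerTorus Lc (fine Lc M) (n + 1))) × Fin (3 + 1)) (↥(pbox (towerTorus Lc (fine Lc M) (n + 1))) × Fin (3 + 1)) ℝ)
  (H₂f : (κ → ℝ) → (κ → ℝ) → Matrix (↥(pbox (towerTorus Lc (fine Lc M) (n + 1))) × Fin (3 + 1)) (↥(pbox (towerTorus Lc (fine Lc M) (n + 1))) × Fin (3 + 1)) ℝ)
  (hH₂ : ∀ v v', (1 / 2 : ℝ) • (H₂f v v' + H₂f v' v)
    = (-2 * c) ^ 2 • ∑ b : ↥(pbox (towerTorus Lc (fine Lc M) (n + 1))) × Fin (3 + 1), ∑ b' : ↥(pbox (towerTorus Lc (fine Lc M) (n + 1))) × Fin (3 + 1), (hv v b * hv v' b') • T₂ b b' + Λ₂ v v')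
  (H'₂f : (κ → ℝ) → (κ → ℝ) → Matrix (↥(pbox (towerTorus Lc (fine Lc M) (n + 1))) × Fin (3 + 1)) (↥(pbox (towerTorus Lc (fine Lc M) (n + 1))) × Fin (3 + 1)) ℝ)
  (hH'₂f : ∀ v v', H'₂f v v' = ((-(c • Matrix.diagonal (fun b : (↥(pbox (towerTorus Lc (fine Lc M) (n + 1))) × Fin (3 + 1)) => lv v b.1))) * (-(c • Matrix.diagonal (fun b : (↥(pbox (towerTorus Lc (fine Lc M) (n + 1))) × Fin (3 + 1)) => lv v' b.1))))ᵀ * H₀ + (-((-(c • Matrix.diagonal (fun b : (↥(pbox (towerTorus Lc (fine Lc M) (n + 1))) × Fin (3 + 1)) => lv v b.1)))ᵀ * H₁f v') + -((-(c • Matrix.diagonal (fun b : (↥(pbox (towerTorus Lc (fine Lc M) (n + 1))) × Fin (3 + 1)) => lv v b.1)))ᵀ * H₀ * (-(c • Matrix.diagonal (fun b : (↥(pbox (towerTorus Lc (fine Lc M) (n + 1))) × Fin (3 + 1)) => lv v' b.1)))))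
    + ((-((-(c • Matrix.diagonal (fun b : (↥(pbox (towerTorus Lc (fine Lc M) (n + 1))) × Fin (3 + 1)) => lv v b.1)))ᵀ * H₁f v') + -((-(c • Matrix.diagonal (fun b : (↥(pbox (towerTorus Lc (fine Lc M) (n + 1))) × Fin (3 + 1)) => lv v b.1)))ᵀ * H₀ * (-(c • Matrix.diagonal (fun b : (↥(pbox (towerTorus Lc (fine Lc M) (n + 1))) × Fin (3 + 1)) => lv v' b.1))))) + (H₂f v v' + H₁f v * (-(c • Matrix.diagonal (fun b : (↥(pbox (towerTorus Lc (fine Lc M) (n + 1))) × Fin (3 + 1)) => lv v' b.1))) + (H₁f v * (-(c • Matrix.diagonal (fun b : (↥(pbox (towerTorus Lc (fine Lc M) (n + 1))) × Fin (3 + 1)) => lv v' b.1))) + H₀ * ((-(c • Matrix.diagonal (fun b : (↥(pbox (towerTorus Lc (fine Lc M) (n + 1))) × Fin (3 + 1)) => lv v b.1))) * (-(c • Matrix.diagonal (fun b : (↥(pbox (towerTorus Lc (fine Lc M) (n + 1))) × Fin (3 + 1)) => lv v' b.1))))))))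
  (r : ℝ) (hr : (-2 * c) * r = Pn.cE (n + 1 + 1)) (a a' : κ)
  -- THE SECOND-ORDER H-SIDE LOCK ROW on the free pins `Pn.cE ∕ Pn.cE₂ (n+2)` (road A-1 l.67863)
  (hcE₂ : (Pn.cE (n + 1 + 1)) ^ 2 = Pn.cE₂ (n + 1 + 1))
  -- THE DOOR (v10, SPEC-64 §3 (ii-A)(b)): a DISPLAYED torus table `D` on the `ff` slots, carried through the row additively
  (D : Matrix (↥(pbox (towerTorus Lc (fine Lc M) (n + 1))) × Fin (3 + 1)) (↥(pbox (towerTorus Lc (fine Lc M) (n + 1))) × Fin (3 + 1)) ℝ)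
  -- (J-Λ₂)+D: the remainder of #7 against PART 23's two MIXED words PLUS THE DOOR, entrywise (displayed; the door-free row is `TowerHN2Row`'s (J-Λ₂))
  (hJΛ₂ : ∀ (p q : ↥(pbox (towerTorus Lc (fine Lc M) (n + 1)))) (α β : Fin (3 + 1)),
    (Λ₂ (r • (Pi.single a (1 : ℝ) : κ → ℝ)) (r • (Pi.single a' (1 : ℝ) : κ → ℝ))
            + c • (Matrix.diagonal (fun b : ↥(pbox (towerTorus Lc (fine Lc M) (n + 1))) × Fin (3 + 1) => lv (r • (Pi.single a (1 : ℝ) : κ → ℝ)) b.1) * Λ₁ (r • (Pi.single a' (1 : ℝ) : κ → ℝ))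
              - Λ₁ (r • (Pi.single a' (1 : ℝ) : κ → ℝ)) * Matrix.diagonal (fun b : ↥(pbox (towerTorus Lc (fine Lc M) (n + 1))) × Fin (3 + 1) => lv (r • (Pi.single a (1 : ℝ) : κ → ℝ)) b.1)
              + (Matrix.diagonal (fun b : ↥(pbox (towerTorus Lc (fine Lc M) (n + 1))) × Fin (3 + 1) => lv (r • (Pi.single a' (1 : ℝ) : κ → ℝ)) b.1) * Λ₁ (r • (Pi.single a (1 : ℝ) : κ → ℝ))
                - Λ₁ (r • (Pi.single a (1 : ℝ) : κ → ℝ)) * Matrix.diagonal (fun b : ↥(pbox (towerTorus Lc (fine Lc M) (n + 1))) × Fin (3 + 1) => lv (r • (Pi.single a' (1 : ℝ) : κ → ℝ)) b.1)))) (p, α) (q, β)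
      = (∑ u : ↥(pbox (towerTorus Lc (fine Lc M) (n + 1))), ∑ κ : Fin (3 + 1), ∑ w : ↥(pbox M), ∑ ρ : Fin (3 + 1),
          perF (towerTorus Lc (fine Lc M) (n + 1)) (AN (Roots.ctr Lc) (n + 1)) (u, Sum.inl κ) (wrapPt (towerTorus Lc (fine Lc M) (n + 1)) (((Lc ^ (n + 1 + 1) : ℕ) : ℤ) • yN a), Sum.inr (μN a))
            * (perF (towerTorus Lc (fine Lc M) (n + 1)) (AN (Roots.ctr Lc) (n + 1)) (wrapPt (towerTorus Lc (fine Lc M) (n + 1)) (((Lc ^ (n + 1 + 1) : ℕ) : ℤ) • (w : Site (3 + 1))), Sum.inr ρ) (wrapPt (towerTorus Lc (fine Lc M) (n + 1)) (((Lc ^ (n + 1 + 1) : ℕ) : ℤ) • yN a'), Sum.inr (μN a'))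
                * perF (towerTorus Lc (fine Lc M) (n + 1)) (dper (towerTorus Lc (fine Lc M) (n + 1)) (fun X Z i₁ i₂ => ∑' m : Site (3 + 1),
            ((1 / 2 : ℝ) • (M2Of 3 (Lc ^ (n + 1 + 1)) (tabsCompG (n + 1 + 1) (one_le_of_neZero Lc) (Roots.ctr Lc).hr (Pn.cM (n + 1 + 1))).mixFF 0 κ (u : Site (3 + 1)) ρ (translate M (w : Site (3 + 1)) m) + sgnK (trK (M2Of 3 (Lc ^ (n + 1 + 1)) (tabsCompG (n + 1 + 1) (one_le_of_neZero Lc) (Roots.ctr Lc).hr (Pn.cM (n + 1 + 1))).mixFF 0 κ (u : Site (3 + 1)) ρ (translate M (w : Site (3 + 1)) m))))) X Z i₁ i₂)) (p, Sum.inl α) (q, Sum.inl β)))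
          + (∑ u : ↥(pbox (towerTorus Lc (fine Lc M) (n + 1))), ∑ κ : Fin (3 + 1), ∑ w : ↥(pbox M), ∑ ρ : Fin (3 + 1),
          perF (towerTorus Lc (fine Lc M) (n + 1)) (AN (Roots.ctr Lc) (n + 1)) (u, Sum.inl κ) (wrapPt (towerTorus Lc (fine Lc M) (n + 1)) (((Lc ^ (n + 1 + 1) : ℕ) : ℤ) • yN a'), Sum.inr (μN a'))
            * (perF (towerTorus Lc (fine Lc M) (n + 1)) (AN (Roots.ctr Lc) (n + 1)) (wrapPt (towerTorus Lc (fine Lc M) (n + 1)) (((Lc ^ (n + 1 + 1) : ℕ) : ℤ) • (w : Site (3 + 1))), Sum.inr ρ) (wrapPt (towerTorus Lc (fine Lc M) (n + 1)) (((Lc ^ (n + 1 + 1) : ℕ) : ℤ) • yN a), Sum.inr (μN a))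
                * perF (towerTorus Lc (fine Lc M) (n + 1)) (dper (towerTorus Lc (fine Lc M) (n + 1)) (fun X Z i₁ i₂ => ∑' m : Site (3 + 1),
            ((1 / 2 : ℝ) • (M2Of 3 (Lc ^ (n + 1 + 1)) (tabsCompG (n + 1 + 1) (one_le_of_neZero Lc) (Roots.ctr Lc).hr (Pn.cM (n + 1 + 1))).mixFF 0 κ (u : Site (3 + 1)) ρ (translate M (w : Site (3 + 1)) m) + sgnK (trK (M2Of 3 (Lc ^ (n + 1 + 1)) (tabsCompG (n + 1 + 1) (one_le_of_neZero Lc) (Roots.ctr Lc).hr (Pn.cM (n + 1 + 1))).mixFF 0 κ (u : Site (3 + 1)) ρ (translate M (w : Site (3 + 1)) m))))) X Z i₁ i₂)) (p, Sum.inl α) (q, Sum.inl β)))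
        + D (p, α) (q, β))

include hhvl hlv hJW hH₀ hT₂ hX₂ hH₁ hH₂ hH'₂f hr hcE₂ hJΛ₂ in
/-- [folklore] **`hHN2_of_locks_of_junctions_door_graded` — THE SECOND-ORDER H-ROW AT `(a, a′)` WITH THE DOOR MOVED RIGHT**: under `TowerHN2Row`'s letters, the lock `hcE₂`, (J-X₂) and the
door-carrying junction row (J-Λ₂)+D `hJΛ₂`, `½•(H′₂f (r•e_a) (r•e_{a′}) + H′₂f (r•e_{a′}) (r•e_a)) = (perF T (dper T (x w ↦ Σ'_e WN♮ (μN a) (yN a) (μN a′) (translate M (yN a′) e) x w)))|ff + D`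
(the door-free `TowerHN2Row.hHN2_of_locks_of_junctions` at the shifted names `Λ₂ − D`, `H₂f − D`, `H′₂f − D`). -/
theorem hHN2_of_locks_of_junctions_door_graded :
    (1 / 2 : ℝ) • (H'₂f (r • (Pi.single a (1 : ℝ) : κ → ℝ)) (r • (Pi.single a' (1 : ℝ) : κ → ℝ))
          + H'₂f (r • (Pi.single a' (1 : ℝ) : κ → ℝ)) (r • (Pi.single a (1 : ℝ) : κ → ℝ)))
      = (perF (towerTorus Lc (fine Lc M) (n + 1)) (dper (towerTorus Lc (fine Lc M) (n + 1))
          (fun X Z i₁ i₂ => ∑' e : Site (3 + 1), ((1 / 2 : ℝ) • ((WchartOf (fun _ => compChart (Roots.ctr Lc).rc Lc (n + 1 + 1) ((Roots.ctr Lc).s (n + 1 + 1)) (Lc ^ (n + 1 + 1))) (tabsCompG (n + 1 + 1) (one_le_of_neZero Lc) (Roots.ctr Lc).hr (Pn.cM (n + 1 + 1))) (Pn.cE (n + 1 + 1)) (Pn.cVH (n + 1 + 1)) (Pn.cΛ (n + 1 + 1)) (Pn.cE₂ (n + 1 + 1)) (Pn.cB (n + 1 + 1)) (Pn.T (n + 1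 + 1)) 0) (μN a) (yN a) (μN a') (translate M (yN a') e)
            + sgnK (trK ((WchartOf (fun _ => compChart (Roots.ctr Lc).rc Lc (n + 1 + 1) ((Roots.ctr Lc).s (n + 1 + 1)) (Lc ^ (n + 1 + 1))) (tabsCompG (n + 1 + 1) (one_le_of_neZero Lc) (Roots.ctr Lc).hr (Pn.cM (n + 1 + 1))) (Pn.cE (n + 1 + 1)) (Pn.cVH (n + 1 + 1)) (Pn.cΛ (n + 1 + 1)) (Pn.cE₂ (n + 1 + 1)) (Pn.cB (n + 1 + 1)) (Pn.T (n + 1 + 1)) 0) (μN a) (yN a) (μN a') (translate M (yN a') e))))) X Z i₁ i₂))).submatrix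
          (fun b : ↥(pbox (towerTorus Lc (fine Lc M) (n + 1))) × Fin (3 + 1) => ((b.1, Sum.inl b.2) : Idx (towerTorus Lc (fine Lc M) (n + 1)) (Fib 3)))
          (fun b : ↥(pbox (towerTorus Lc (fine Lc M) (n + 1))) × Fin (3 + 1) => ((b.1, Sum.inl b.2) : Idx (towerTorus Lc (fine Lc M) (n + 1)) (Fib 3)))
        + D := by
  -- the door-free row for the SHIFTED names `Λ₂ − D`, `H₂f − D`, `H′₂f − D` (the closed forms are affine with unit coefficient in `H₂f`)
  have h := hHN2_of_locks_of_junctions_graded M n c Pn yN μN hv hhvl lv hlv hJW hH₀ T₂ hT₂ hX₂ Λ₁ H₁f hH₁ (fun v v' => Λ₂ v v' - D) (fun v v' => H₂f v v' - D)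
    (fun v v' => by
      rw [show (1 / 2 : ℝ) • ((H₂f v v' - D) + (H₂f v' v - D)) = (1 / 2 : ℝ) • (H₂f v v' + H₂f v' v) - D by module, hH₂ v v']
      abel)
    (fun v v' => H'₂f v v' - D) (fun v v' => by rw [hH'₂f v v']; abel) r hr a a' hcE₂
    (fun p q α β => by
      have e := hJΛ₂ p q α β
      simp only [Matrix.add_apply, Matrix.sub_apply] at e ⊢
      linarith)
  rw [show (1 / 2 : ℝ) • (H'₂f (r • (Pi.single a (1 : ℝ) : κ → ℝ)) (r • (Pi.single a' (1 : ℝ) : κ → ℝ)) + H'₂f (r • (Pi.single a' (1 : ℝ) : κ → ℝ)) (r • (Pi.single a (1 : ℝ) : κ → ℝ)))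
      = (1 / 2 : ℝ) • ((H'₂f (r • (Pi.single a (1 : ℝ) : κ → ℝ)) (r • (Pi.single a' (1 : ℝ) : κ → ℝ)) - D) + (H'₂f (r • (Pi.single a' (1 : ℝ) : κ → ℝ)) (r • (Pi.single a (1 : ℝ) : κ → ℝ)) - D)) + D by module, h]

end Row


/-! ## §2 The row for every label pair `(μ, y; ν, y′)`, `y, y′ : ℤ⁴`, with the door family moved right (per box) -/

section Family

variable {Lc : ℕ} [NeZero Lc] (M : Fin (3 + 1) → ℕ) [∀ μ, NeZero (M μ)] (n : ℕ) (c : ℝ) (Pn : Pins)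
  -- §1's letters on the source type `κ := pbox M × Fin 4` (labels `yN a := ↑a.1`, `μN a := a.2`, as (Fam) `TowerQN2RowFamily`)
  (hv : ((↥(pbox M) × Fin (3 + 1)) → ℝ) → (↥(pbox (towerTorus Lc (fine Lc M) (n + 1))) × Fin (3 + 1) → ℝ))
  (hhvl : ∀ (r : ℝ) (x y : (↥(pbox M) × Fin (3 + 1)) → ℝ), hv (r • x + y) = r • hv x + hv y)
  (lv : ((↥(pbox M) × Fin (3 + 1)) → ℝ) → (↥(pbox (towerTorus Lc (fine Lc M) (n + 1))) → ℝ))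
  (hlv : ∀ (r : ℝ) (x y : (↥(pbox M) × Fin (3 + 1)) → ℝ), lv (r • x + y) = r • lv x + lv y)
  (hJW : ∀ (a : (↥(pbox M) × Fin (3 + 1))) (b : ↥(pbox (towerTorus Lc (fine Lc M) (n + 1))) × Fin (3 + 1)), hv (Pi.single a 1) b
      = perF (towerTorus Lc (fine Lc M) (n + 1)) (AN (Roots.ctr Lc) (n + 1)) (b.1, Sum.inl b.2)
          (wrapPt (towerTorus Lc (fine Lc M) (n + 1)) (((Lc ^ (n + 1 + 1) : ℕ) : ℤ) • (a.1 : Site (3 + 1))), Sum.inr a.2)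
        - ∑ s : ↥(pbox (towerTorus Lc (fine Lc M) (n + 1))), tgrad (towerTorus Lc (fine Lc M) (n + 1)) (b.1, Sum.inl b.2) s * lv (Pi.single a 1) s)
  {H₀ : Matrix (↥(pbox (towerTorus Lc (fine Lc M) (n + 1))) × Fin (3 + 1)) (↥(pbox (towerTorus Lc (fine Lc M) (n + 1))) × Fin (3 + 1)) ℝ}
  (hH₀ : H₀ = (perF (towerTorus Lc (fine Lc M) (n + 1)) (bhKStepSh 3 Lc (Dsh Lc) 0)).submatrix
      (fun b : ↥(pbox (towerTorus Lc (fine Lc M) (n + 1))) × Fin (3 + 1) => ((b.1, Sum.inl b.2) : Idx (towerTorus Lc (fine Lc M) (n + 1)) (Fib 3)))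
      (fun b : ↥(pbox (towerTorus Lc (fine Lc M) (n + 1))) × Fin (3 + 1) => ((b.1, Sum.inl b.2) : Idx (towerTorus Lc (fine Lc M) (n + 1)) (Fib 3))))
  (T₂ : ↥(pbox (towerTorus Lc (fine Lc M) (n + 1))) × Fin (3 + 1) → ↥(pbox (towerTorus Lc (fine Lc M) (n + 1))) × Fin (3 + 1) → Matrix (↥(pbox (towerTorus Lc (fine Lc M) (n + 1))) × Fin (3 + 1)) (↥(pbox (towerTorus Lc (fine Lc M) (n + 1))) × Fin (3 + 1)) ℝ)
  (hT₂ : ∀ b b' : ↥(pbox (towerTorus Lc (fine Lc M) (n + 1))) × Fin (3 + 1), T₂ b b' = (1 / 2 : ℝ) • ((perF (towerTorus Lc (fine Lc M) (n + 1)) (dper (towerTorus Lc (fine Lc M) (n + 1)) (fun X Z i₁ i₂ => ∑' m : Site (3 + 1),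
              ((1 / 2 : ℝ) • (wilsonW₂ 3 (Pn.T (n + 1 + 1)) b.2 (b.1 : Site (3 + 1)) b'.2 (translate (towerTorus Lc (fine Lc M) (n + 1)) (b'.1 : Site (3 + 1)) m)
                + sgnK (trK (wilsonW₂ 3 (Pn.T (n + 1 + 1)) b.2 (b.1 : Site (3 + 1)) b'.2 (translate (towerTorus Lc (fine Lc M) (n + 1)) (b'.1 : Site (3 + 1)) m))))) X Z i₁ i₂))).submatrix
            (fun b : ↥(pbox (towerTorus Lc (fine Lc M) (n + 1))) × Fin (3 + 1) => ((b.1, Sum.inl b.2) : Idx (towerTorus Lc (fine Lc M) (n + 1)) (Fib 3)))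
            (fun b : ↥(pbox (towerTorus Lc (fine Lc M) (n + 1))) × Fin (3 + 1) => ((b.1, Sum.inl b.2) : Idx (towerTorus Lc (fine Lc M) (n + 1)) (Fib 3)))
        + (perF (towerTorus Lc (fine Lc M) (n + 1)) (dper (towerTorus Lc (fine Lc M) (n + 1)) (fun X Z i₁ i₂ => ∑' m : Site (3 + 1),
              ((1 / 2 : ℝ) • (wilsonW₂ 3 (Pn.T (n + 1 + 1)) b'.2 (b'.1 : Site (3 + 1)) b.2 (translate (towerTorus Lc (fine Lc M) (n + 1)) (b.1 : Site (3 + 1)) m)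
                + sgnK (trK (wilsonW₂ 3 (Pn.T (n + 1 + 1)) b'.2 (b'.1 : Site (3 + 1)) b.2 (translate (towerTorus Lc (fine Lc M) (n + 1)) (b.1 : Site (3 + 1)) m))))) X Z i₁ i₂))).submatrix
            (fun b : ↥(pbox (towerTorus Lc (fine Lc M) (n + 1))) × Fin (3 + 1) => ((b.1, Sum.inl b.2) : Idx (towerTorus Lc (fine Lc M) (n + 1)) (Fib 3)))
            (fun b : ↥(pbox (towerTorus Lc (fine Lc M) (n + 1))) × Fin (3 + 1) => ((b.1, Sum.inl b.2) : Idx (towerTorus Lc (fine Lc M) (n + 1)) (Fib 3)))))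
  (hX₂ : ∀ (b : ↥(pbox (towerTorus Lc (fine Lc M) (n + 1))) × Fin (3 + 1)) (lam : ↥(pbox (towerTorus Lc (fine Lc M) (n + 1))) → ℝ),
    ∑ b' : ↥(pbox (towerTorus Lc (fine Lc M) (n + 1))) × Fin (3 + 1), (∑ s : ↥(pbox (towerTorus Lc (fine Lc M) (n + 1))), tgrad (towerTorus Lc (fine Lc M) (n + 1)) (b'.1, Sum.inl b'.2) s * lam s) • T₂ b b'
      = (1 / 2 : ℝ) • ((perF (towerTorus Lc (fine Lc M) (n + 1)) (dper (towerTorus Lc (fine Lc M) (n + 1)) (wilsonA 3 b.2 (b.1 : Site (3 + 1))))).submatrix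
            (fun b : ↥(pbox (towerTorus Lc (fine Lc M) (n + 1))) × Fin (3 + 1) => ((b.1, Sum.inl b.2) : Idx (towerTorus Lc (fine Lc M) (n + 1)) (Fib 3)))
            (fun b : ↥(pbox (towerTorus Lc (fine Lc M) (n + 1))) × Fin (3 + 1) => ((b.1, Sum.inl b.2) : Idx (towerTorus Lc (fine Lc M) (n + 1)) (Fib 3))) * Matrix.diagonal (fun b : ↥(pbox (towerTorus Lc (fine Lc M) (n + 1))) × Fin (3 + 1) => lam b.1)
        - Matrix.diagonal (fun b : ↥(pbox (towerTorus Lc (fine Lc M) (n + 1))) × Fin (3 + 1) => lam b.1) * (perF (towerTorus Lc (fine Lc M) (n + 1)) (dper (towerTorus Lc (fine Lc M) (n + 1)) (wilsonA 3 b.2 (b.1 : Site (3 + 1))))).submatrix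
            (fun b : ↥(pbox (towerTorus Lc (fine Lc M) (n + 1))) × Fin (3 + 1) => ((b.1, Sum.inl b.2) : Idx (towerTorus Lc (fine Lc M) (n + 1)) (Fib 3)))
            (fun b : ↥(pbox (towerTorus Lc (fine Lc M) (n + 1))) × Fin (3 + 1) => ((b.1, Sum.inl b.2) : Idx (towerTorus Lc (fine Lc M) (n + 1)) (Fib 3)))))
  (Λ₁ : ((↥(pbox M) × Fin (3 + 1)) → ℝ) → Matrix (↥(pbox (towerTorus Lc (fine Lc M) (n + 1))) × Fin (3 + 1)) (↥(pbox (towerTorus Lc (fine Lc M) (n + 1))) × Fin (3 + 1)) ℝ)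
  (H₁f : ((↥(pbox M) × Fin (3 + 1)) → ℝ) → Matrix (↥(pbox (towerTorus Lc (fine Lc M) (n + 1))) × Fin (3 + 1)) (↥(pbox (towerTorus Lc (fine Lc M) (n + 1))) × Fin (3 + 1)) ℝ)
  (hH₁ : ∀ v, H₁f v = (-2 * c) • ∑ b : ↥(pbox (towerTorus Lc (fine Lc M) (n + 1))) × Fin (3 + 1), hv v b •
        (perF (towerTorus Lc (fine Lc M) (n + 1)) (dper (towerTorus Lc (fine Lc M) (n + 1)) (wilsonA 3 b.2 (b.1 : Site (3 + 1))))).submatrix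
            (fun b : ↥(pbox (towerTorus Lc (fine Lc M) (n + 1))) × Fin (3 + 1) => ((b.1, Sum.inl b.2) : Idx (towerTorus Lc (fine Lc M) (n + 1)) (Fib 3)))
            (fun b : ↥(pbox (towerTorus Lc (fine Lc M) (n + 1))) × Fin (3 + 1) => ((b.1, Sum.inl b.2) : Idx (towerTorus Lc (fine Lc M) (n + 1)) (Fib 3)))
      + Λ₁ v)
  (Λ₂ : ((↥(pbox M) × Fin (3 + 1)) → ℝ) → ((↥(pbox M) × Fin (3 + 1)) → ℝ) → Matrix (↥(pbox (towerTorus Lc (fine Lc M) (n + 1))) × Fin (3 + 1)) (↥(pbox (towerTorus Lc (fine Lc M) (n + 1))) × Fin (3 + 1)) ℝ)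
  (H₂f : ((↥(pbox M) × Fin (3 + 1)) → ℝ) → ((↥(pbox M) × Fin (3 + 1)) → ℝ) → Matrix (↥(pbox (towerTorus Lc (fine Lc M) (n + 1))) × Fin (3 + 1)) (↥(pbox (towerTorus Lc (fine Lc M) (n + 1))) × Fin (3 + 1)) ℝ)
  (hH₂ : ∀ v v', (1 / 2 : ℝ) • (H₂f v v' + H₂f v' v)
    = (-2 * c) ^ 2 • ∑ b : ↥(pbox (towerTorus Lc (fine Lc M) (n + 1))) × Fin (3 + 1), ∑ b' : ↥(pbox (towerTorus Lc (fine Lc M) (n + 1))) × Fin (3 + 1), (hv v b * hv v' b') • T₂ b b' + Λ₂ v v')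
  (H'₂f : ((↥(pbox M) × Fin (3 + 1)) → ℝ) → ((↥(pbox M) × Fin (3 + 1)) → ℝ) → Matrix (↥(pbox (towerTorus Lc (fine Lc M) (n + 1))) × Fin (3 + 1)) (↥(pbox (towerTorus Lc (fine Lc M) (n + 1))) × Fin (3 + 1)) ℝ)
  (hH'₂f : ∀ v v', H'₂f v v' = ((-(c • Matrix.diagonal (fun b : (↥(pbox (towerTorus Lc (fine Lc M) (n + 1))) × Fin (3 + 1)) => lv v b.1))) * (-(c • Matrix.diagonal (fun b : (↥(pbox (towerTorus Lc (fine Lc M) (n + 1))) × Fin (3 + 1)) => lv v' b.1))))ᵀ * H₀ + (-((-(c • Matrix.diagonal (fun b : (↥(pbox (towerTorus Lc (fine Lc M) (n + 1))) × Fin (3 + 1)) => lv v b.1)))ᵀ * H₁f v') + -((-(c • Matrix.diagonal (fun b : (↥(pbox (towerTorus Lc (fine Lc M) (n + 1))) × Fin (3 + 1)) => lv v b.1)))ᵀ * H₀ * (-(c • Matrix.diagonal (fun b : (↥(pbox (towerTorus Lc (fine Lc M) (n + 1))) × Fin (3 + 1)) => lv v' b.1)))))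
    + ((-((-(c • Matrix.diagonal (fun b : (↥(pbox (towerTorus Lc (fine Lc M) (n + 1))) × Fin (3 + 1)) => lv v b.1)))ᵀ * H₁f v') + -((-(c • Matrix.diagonal (fun b : (↥(pbox (towerTorus Lc (fine Lc M) (n + 1))) × Fin (3 + 1)) => lv v b.1)))ᵀ * H₀ * (-(c • Matrix.diagonal (fun b : (↥(pbox (towerTorus Lc (fine Lc M) (n + 1))) × Fin (3 + 1)) => lv v' b.1))))) + (H₂f v v' + H₁f v * (-(c • Matrix.diagonal (fun b : (↥(pbox (towerTorus Lc (fine Lc M) (n + 1))) × Fin (3 + 1)) => lv v' b.1))) + (H₁f v * (-(c • Matrix.diagonal (fun b : (↥(pbox (towerTorus Lc (fine Lc M) (n + 1))) × Fin (3 + 1)) => lv v' b.1))) + H₀ * ((-(c • Matrix.diagonal (fun b : (↥(pbox (towerTorus Lc (fine Lc M) (n + 1))) × Fin (3 + 1)) => lv v b.1))) * (-(c • Matrix.diagonal (fun b : (↥(pbox (towerTorus Lc (fine Lc M) (n + 1))) × Fin (3 + 1)) => lv v' b.1))))))))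
  (r : ℝ) (hr : (-2 * c) * r = Pn.cE (n + 1 + 1))
  -- the direction FAMILY: one top one-shot source per label, scaled by the pin's `r` (as #5 ∕ (Fam))
  (dv : Fin (3 + 1) × Site (3 + 1) → ((↥(pbox M) × Fin (3 + 1)) → ℝ))
  (hdv : ∀ (μ : Fin (3 + 1)) (y : Site (3 + 1)), dv (μ, y) = r • (Pi.single (wrapPt M y, μ) (1 : ℝ) : (↥(pbox M) × Fin (3 + 1)) → ℝ))
  (hcE₂ : (Pn.cE (n + 1 + 1)) ^ 2 = Pn.cE₂ (n + 1 + 1))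
  -- THE DOOR FAMILY (v10): a DISPLAYED torus table `D a a′` per source pair
  (D : (↥(pbox M) × Fin (3 + 1)) → (↥(pbox M) × Fin (3 + 1)) → Matrix (↥(pbox (towerTorus Lc (fine Lc M) (n + 1))) × Fin (3 + 1)) (↥(pbox (towerTorus Lc (fine Lc M) (n + 1))) × Fin (3 + 1)) ℝ)
  -- (J-Λ₂)+D for EVERY pair of sources (displayed)
  (hJΛ₂ : ∀ (a a' : (↥(pbox M) × Fin (3 + 1))) (p q : ↥(pbox (towerTorus Lc (fine Lc M) (n + 1)))) (α β : Fin (3 + 1)),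
    (Λ₂ (r • (Pi.single a (1 : ℝ) : (↥(pbox M) × Fin (3 + 1)) → ℝ)) (r • (Pi.single a' (1 : ℝ) : (↥(pbox M) × Fin (3 + 1)) → ℝ))
            + c • (Matrix.diagonal (fun b : ↥(pbox (towerTorus Lc (fine Lc M) (n + 1))) × Fin (3 + 1) => lv (r • (Pi.single a (1 : ℝ) : (↥(pbox M) × Fin (3 + 1)) → ℝ)) b.1) * Λ₁ (r • (Pi.single a' (1 : ℝ) : (↥(pbox M) × Fin (3 + 1)) → ℝ))
              - Λ₁ (r • (Pi.single a' (1 : ℝ) : (↥(pbox M) × Fin (3 + 1)) → ℝ)) * Matrix.diagonal (fun b : ↥(pbox (towerTorus Lc (fine Lc M) (n + 1))) × Fin (3 + 1) => lv (r • (Pi.single a (1 : ℝ) : (↥(pbox M) × Fin (3 + 1)) → ℝ)) b.1)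
              + (Matrix.diagonal (fun b : ↥(pbox (towerTorus Lc (fine Lc M) (n + 1))) × Fin (3 + 1) => lv (r • (Pi.single a' (1 : ℝ) : (↥(pbox M) × Fin (3 + 1)) → ℝ)) b.1) * Λ₁ (r • (Pi.single a (1 : ℝ) : (↥(pbox M) × Fin (3 + 1)) → ℝ))
                - Λ₁ (r • (Pi.single a (1 : ℝ) : (↥(pbox M) × Fin (3 + 1)) → ℝ)) * Matrix.diagonal (fun b : ↥(pbox (towerTorus Lc (fine Lc M) (n + 1))) × Fin (3 + 1) => lv (r • (Pi.single a' (1 : ℝ) : (↥(pbox M) × Fin (3 + 1)) → ℝ)) b.1)))) (p, α) (q, β)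
      = (∑ u : ↥(pbox (towerTorus Lc (fine Lc M) (n + 1))), ∑ κ : Fin (3 + 1), ∑ w : ↥(pbox M), ∑ ρ : Fin (3 + 1),
          perF (towerTorus Lc (fine Lc M) (n + 1)) (AN (Roots.ctr Lc) (n + 1)) (u, Sum.inl κ) (wrapPt (towerTorus Lc (fine Lc M) (n + 1)) (((Lc ^ (n + 1 + 1) : ℕ) : ℤ) • (a.1 : Site (3 + 1))), Sum.inr (a.2))
            * (perF (towerTorus Lc (fine Lc M) (n + 1)) (AN (Roots.ctr Lc) (n + 1)) (wrapPt (towerTorus Lc (fine Lc M) (n + 1)) (((Lc ^ (n + 1 + 1) : ℕ) : ℤ) • (w : Site (3 + 1))), Sum.inr ρ) (wrapPt (towerTorus Lc (fine Lc M) (n + 1)) (((Lc ^ (n + 1 + 1) : ℕ) : ℤ) • (a'.1 : Site (3 + 1))), Sum.inr (a'.2))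
                * perF (towerTorus Lc (fine Lc M) (n + 1)) (dper (towerTorus Lc (fine Lc M) (n + 1)) (fun X Z i₁ i₂ => ∑' m : Site (3 + 1),
            ((1 / 2 : ℝ) • (M2Of 3 (Lc ^ (n + 1 + 1)) (tabsCompG (n + 1 + 1) (one_le_of_neZero Lc) (Roots.ctr Lc).hr (Pn.cM (n + 1 + 1))).mixFF 0 κ (u : Site (3 + 1)) ρ (translate M (w : Site (3 + 1)) m) + sgnK (trK (M2Of 3 (Lc ^ (n + 1 + 1)) (tabsCompG (n + 1 + 1) (one_le_of_neZero Lc) (Roots.ctr Lc).hr (Pn.cM (n + 1 + 1))).mixFF 0 κ (u : Site (3 + 1)) ρ (translate M (w : Site (3 + 1)) m))))) X Z i₁ i₂)) (p, Sum.inl α) (q, Sum.inl β)))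
          + (∑ u : ↥(pbox (towerTorus Lc (fine Lc M) (n + 1))), ∑ κ : Fin (3 + 1), ∑ w : ↥(pbox M), ∑ ρ : Fin (3 + 1),
          perF (towerTorus Lc (fine Lc M) (n + 1)) (AN (Roots.ctr Lc) (n + 1)) (u, Sum.inl κ) (wrapPt (towerTorus Lc (fine Lc M) (n + 1)) (((Lc ^ (n + 1 + 1) : ℕ) : ℤ) • (a'.1 : Site (3 + 1))), Sum.inr (a'.2))
            * (perF (towerTorus Lc (fine Lc M) (n + 1)) (AN (Roots.ctr Lc) (n + 1)) (wrapPt (towerTorus Lc (fine Lc M) (n + 1)) (((Lc ^ (n + 1 + 1) : ℕ) : ℤ) • (w : Site (3 + 1))), Sum.inr ρ) (wrapPt (towerTorus Lc (fine Lc M) (n + 1)) (((Lc ^ (n + 1 + 1) : ℕ) : ℤ) • (a.1 : Site (3 + 1))), Sum.inr (a.2))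
                * perF (towerTorus Lc (fine Lc M) (n + 1)) (dper (towerTorus Lc (fine Lc M) (n + 1)) (fun X Z i₁ i₂ => ∑' m : Site (3 + 1),
            ((1 / 2 : ℝ) • (M2Of 3 (Lc ^ (n + 1 + 1)) (tabsCompG (n + 1 + 1) (one_le_of_neZero Lc) (Roots.ctr Lc).hr (Pn.cM (n + 1 + 1))).mixFF 0 κ (u : Site (3 + 1)) ρ (translate M (w : Site (3 + 1)) m) + sgnK (trK (M2Of 3 (Lc ^ (n + 1 + 1)) (tabsCompG (n + 1 + 1) (one_le_of_neZero Lc) (Roots.ctr Lc).hr (Pn.cM (n + 1 + 1))).mixFF 0 κ (u : Site (3 + 1)) ρ (translate M (w : Site (3 + 1)) m))))) X Z i₁ i₂)) (p, Sum.inl α) (q, Sum.inl β)))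
        + D a a' (p, α) (q, β))

include hhvl hlv hJW hH₀ hT₂ hX₂ hH₁ hH₂ hH'₂f hr hdv hcE₂ hJΛ₂ in
/-- [folklore] **`hHN2_family_of_locks_of_junctions_door_graded` — v5's ROW SHAPE FOR EVERY LABEL PAIR WITH THE DOOR FAMILY MOVED RIGHT** (per box `M := Mc B`):
`½•(H′₂f (dv (μ,y)) (dv (ν,y′)) + H′₂f (dv (ν,y′)) (dv (μ,y))) = (perF T (dper T (x w ↦ Σ'_e WN♮ μ y ν (translate M y′ e) x w)))|ff + D (wrapPt M y, μ) (wrapPt M y′, ν)`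
(§1 at the wrapped sources + (Fam) `TowerQN2RowFamily.perF_dper_woundEven_wrap`), modulo `hcE₂`, (J-X₂) `hX₂` and (J-Λ₂)+D `hJΛ₂` (all source pairs). -/
theorem hHN2_family_of_locks_of_junctions_door_graded (μ : Fin (3 + 1)) (y : Site (3 + 1)) (ν : Fin (3 + 1)) (y' : Site (3 + 1)) :
    (1 / 2 : ℝ) • (H'₂f (dv (μ, y)) (dv (ν, y')) + H'₂f (dv (ν, y')) (dv (μ, y)))
      = (perF (towerTorus Lc (fine Lc M) (n + 1)) (dper (towerTorus Lc (fine Lc M) (n + 1))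
          (fun X Z i₁ i₂ => ∑' e : Site (3 + 1), ((1 / 2 : ℝ) • ((WchartOf (fun _ => compChart (Roots.ctr Lc).rc Lc (n + 1 + 1) ((Roots.ctr Lc).s (n + 1 + 1)) (Lc ^ (n + 1 + 1))) (tabsCompG (n + 1 + 1) (one_le_of_neZero Lc) (Roots.ctr Lc).hr (Pn.cM (n + 1 + 1))) (Pn.cE (n + 1 + 1)) (Pn.cVH (n + 1 + 1)) (Pn.cΛ (n + 1 + 1)) (Pn.cE₂ (n + 1 + 1)) (Pn.cB (n + 1 + 1)) (Pn.T (n + 1 + 1)) 0) μ y ν (translate M y' e)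
            + sgnK (trK ((WchartOf (fun _ => compChart (Roots.ctr Lc).rc Lc (n + 1 + 1) ((Roots.ctr Lc).s (n + 1 + 1)) (Lc ^ (n + 1 + 1))) (tabsCompG (n + 1 + 1) (one_le_of_neZero Lc) (Roots.ctr Lc).hr (Pn.cM (n + 1 + 1))) (Pn.cE (n + 1 + 1)) (Pn.cVH (n + 1 + 1)) (Pn.cΛ (n + 1 + 1)) (Pn.cE₂ (n + 1 + 1)) (Pn.cB (n + 1 + 1)) (Pn.T (n + 1 + 1)) 0) μ y ν (translate M y' e))))) X Z i₁ i₂))).submatrix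
          (fun b : ↥(pbox (towerTorus Lc (fine Lc M) (n + 1))) × Fin (3 + 1) => ((b.1, Sum.inl b.2) : Idx (towerTorus Lc (fine Lc M) (n + 1)) (Fib 3)))
          (fun b : ↥(pbox (towerTorus Lc (fine Lc M) (n + 1))) × Fin (3 + 1) => ((b.1, Sum.inl b.2) : Idx (towerTorus Lc (fine Lc M) (n + 1)) (Fib 3)))
        + D (wrapPt M y, μ) (wrapPt M y', ν) := by
  have h := hHN2_of_locks_of_junctions_door_graded M n c Pn (fun a : (↥(pbox M) × Fin (3 + 1)) => (a.1 : Site (3 + 1))) (fun a => a.2) hv hhvl lv hlv hJW hH₀ T₂ hT₂ hX₂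
    Λ₁ H₁f hH₁ Λ₂ H₂f hH₂ H'₂f hH'₂f r hr (wrapPt M y, μ) (wrapPt M y', ν) hcE₂ (D (wrapPt M y, μ) (wrapPt M y', ν)) (hJΛ₂ (wrapPt M y, μ) (wrapPt M y', ν))
  rw [hdv, hdv, h, add_left_inj]
  show (perF _ (dper _ (fun X Z i₁ i₂ => ∑' e : Site (3 + 1), ((1 / 2 : ℝ) • ((WchartOf (fun _ => compChart (Roots.ctr Lc).rc Lc (n + 1 + 1) ((Roots.ctr Lc).s (n + 1 + 1)) (Lc ^ (n + 1 + 1))) (tabsCompG (n + 1 + 1) (one_le_of_neZero Lc) (Roots.ctr Lc).hr (Pn.cM (n + 1 + 1))) (Pn.cE (n + 1 + 1)) (Pn.cVH (n + 1 + 1)) (Pn.cΛ (n + 1 + 1)) (Pn.cE₂ (n + 1 + 1)) (Pn.cB (n + 1 + 1)) (Pn.T (n + 1 + 1)) 0) μ ((wrapPt M y : ↥(pbox M)) : Site (3 + 1)) ν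
      (translate M ((wrapPt M y' : ↥(pbox M)) : Site (3 + 1)) e) + sgnK (trK ((WchartOf (fun _ => compChart (Roots.ctr Lc).rc Lc (n + 1 + 1) ((Roots.ctr Lc).s (n + 1 + 1)) (Lc ^ (n + 1 + 1))) (tabsCompG (n + 1 + 1) (one_le_of_neZero Lc) (Roots.ctr Lc).hr (Pn.cM (n + 1 + 1))) (Pn.cE (n + 1 + 1)) (Pn.cVH (n + 1 + 1)) (Pn.cΛ (n + 1 + 1)) (Pn.cE₂ (n + 1 + 1)) (Pn.cB (n + 1 + 1)) (Pn.T (n + 1 + 1)) 0) μ ((wrapPt M y : ↥(pbox M)) : Site (3 + 1)) ν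
      (translate M ((wrapPt M y' : ↥(pbox M)) : Site (3 + 1)) e))))) X Z i₁ i₂))).submatrix _ _ = _
  rw [wrapPt_coe, wrapPt_coe, perF_dper_woundEvenG_wrap]

end Family

end Summit.QuantumFields.BalabanUV.Beta.FP.TowerHN2RowDoorGraded

end
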